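import Mathlib
import HarnessLib
import Literature.MathematicalPhysics.StatisticalMechanics.RenormalisationMapTermLipschitzSub
import Literature.MathematicalPhysics.StatisticalMechanics.RenormalisationMapLipschitzABKM
import Literature.MathematicalPhysics.StatisticalMechanics.RenormalisationMapCounting
import Literature.MathematicalPhysics.StatisticalMechanics.RenormalisationMapP2Fluct
import Literature.MathematicalPhysics.StatisticalMechanics.StrongWeightStepP1
import Literature.MathematicalPhysics.StatisticalMechanics.StrongNormExpLipschitz
import Literature.MathematicalPhysics.StatisticalMechanics.LinearisedMapABKMContraction
import Literature.MathematicalPhysics.StatisticalMechanics.RenormalisationMapLipschitzSlotABKM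
import Literature.MathematicalPhysics.StatisticalMechanics.RelevantHamiltonianSpace
import Literature.MathematicalPhysics.StatisticalMechanics.InitialPolymerActivity
import Literature.MathematicalPhysics.StatisticalMechanics.BlockProductMinusOne

/-!
# The `(p_X − 1)·G(X)` terms of the renormalisation map for the torus data, abstract inner slot:
# summed Lipschitz bound ([ABKM19] Lemma 9.6 / Theorem 6.8, first order — block-sum form)

The block sum `Σ₁ = Σ_{B ∈ blockPartIndex(U)} [(p_B − 1)(RK(B) + u_B) + p_B Φ_B]` of `GradientRG.nextKStep_sub_opC_eq`
(RenormalisationMapRemainder; `p_X = (e^{−H̃})^{U∖X}(e^{H̃})^{X∖U}`) contains terms `(p_X − 1)·G(X)` whose smallness comes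
from the prefactor `p_X − 1 = O(‖H̃‖_{k,0})` and NOT from `G`.  Their Lipschitz difference telescopes as
`(p−1)G − (p'−1)G' = (p − p')·G + (p' − 1)·(G − G')`, and both pieces are instances of the slot form
`RenormalisationMapLipschitzSlotABKM.tayNormLE_subsum_reblockTerm_sub_abkm_slot` (inner family `{∅}`):
the first with data `(H̃, H̃')` and slot `(G, G)`, the second with data `(H̃', 0)` (`e^{−0} = 1`, so the primed
prefactor is `1`; `‖H̃' − 0‖_{k,0} ≤ τ`) and slot `(G − G', G − G')`.  This file records the resulting bound.

* **`tayNormLE_subsum_pMinusOne_sub_abkm_slot`** — the displayed bound.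

Everything is proved; no named fact.

## References
* S. Adams, S. Buchholz, R. Kotecký, S. Müller, arXiv:1910.13564, Lemma 9.6 (proof), Lemma 9.3,
  Lemma 8.3 (iii), Lemma 8.1, Theorem 7.1 (w5)–(w6) [AdamsBuchholzKoteckyMuller2019].
-/

noncomputable section

namespace Literature.MathematicalPhysics.StatisticalMechanics.GradientRG

open scoped BigOperators Classical
open Finset Matrix
open Literature.MathematicalPhysics.StatisticalMechanics.TorusPolymer
  (IsPolymer blocks polys bprod blockOf thicken reblock mem_polys mem_blocks numBlocks isPolymer_blockOf
    thicken_mono thicken_mono_rad thicken_thicken subset_thicken)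
open Literature.Barriers.CriticalPhenomena.LongRangePhi4.Polymer (IsConn components)
open Literature.MathematicalPhysics.QuantumFieldTheory

variable {d M : ℕ} [NeZero M]

/-- **The `(p_X − 1)·G(X)` terms are Lipschitz-small** (slot form; module docstring): for the torus data of
`tayNormLE_subsum_reblockTerm_sub_abkm_slot`, `𝓧' ⊆ {π(X) = U}`, `‖H̃‖,‖H̃'‖ ≤ τ ≤ 1/16`, slot functionals with
`|G(X)| ≤ g(X)`, `|G(X) − G'(X)| ≤ ρ(X)` in `|·|_{T_k^{X*}, w_{k:k+1}^X}`:
`|Σ_X [(p_X−1)G(X) − (p'_X−1)G'(X)]|_{T_{k+1}^{U*},w_{k+1}^U} ≤ [bound of the slot form at (H̃,H̃'), slot (G,G), ρ = 0]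
 + [bound of the slot form at (H̃',0), slot (G−G',G−G') with g := ρ, ρ = 0]`.
[cite: AdamsBuchholzKoteckyMuller2019, Theorem 6.8 / Lemma 9.6 (proof, first order)] -/
theorem tayNormLE_subsum_pMinusOne_sub_abkm_slot {L N Mord R n p r₀ : ℕ} {θbar lam μ δ₁ δ₀ A𝒫 h A : ℝ}
    {𝒞 : ℕ → (Fin d → ZMod M) → ℝ} (hd : 3 ≤ d) (hLodd : Odd L) (hL : 2 ^ (d + 3) + 16 * R ≤ L)
    (hR2 : 2 ≤ R) (hM : M = L ^ N) {k : ℕ} (hkN : k + 1 ≤ N) (hp : d / 2 + 1 ≤ p) (hMord : d / 2 + 1 ≤ Mord)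
    (hB : AbkmWeightBounds L N Mord R n θbar lam μ δ₁ δ₀ A𝒫 𝒞
      (abkmWeightData L N Mord R θbar (schedDelta δ₀ δ₁ N) 𝒞))
    (hδ₀ : 0 < δ₀) (hδ₁ : 0 < δ₁) (hh : 0 < h) (hh0 : hZeroSq d R δ₀ δ₁ ≤ h ^ 2)
    {U : Finset (Fin d → ZMod M)} (hU : IsPolymer (L ^ (k + 1)) U)
    {𝓧' : Finset (Finset (Fin d → ZMod M))}
    (h𝓧' : 𝓧' ⊆ (polys (L ^ k) univ).filter (fun X => reblock (L ^ k) (L * L ^ k) X = U))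
    {Ht Ht' : RelevantHamiltonian ℂ d} {τ : ℝ}
    (hHt : hamNorm (fieldWt h (L : ℝ) d k) ((L : ℝ) ^ k) (L ^ (d * k)) Ht ≤ τ)
    (hHt' : hamNorm (fieldWt h (L : ℝ) d k) ((L : ℝ) ^ k) (L ^ (d * k)) Ht' ≤ τ) (hτ : τ ≤ 1 / 16)
    {Gs Gs' : Finset (Fin d → ZMod M) → ((Fin d → ZMod M) → ℝ) → ℂ} {g ρ : Finset (Fin d → ZMod M) → ℝ}
    (hSlot : ∀ X ∈ 𝓧', ∀ X₁ ∈ ({∅} : Finset (Finset (Fin d → ZMod M))), TayNormLE ((abkmNormParams L N Mord R p r₀ h θbar A (schedDelta δ₀ δ₁ N) 𝒞).gauge k (X \ X₁)) r₀ ((abkmWeightData L N Mord R θbar (schedDelta δ₀ δ₁ N) 𝒞).midWeight k (X \ X₁))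
      (Gs (X \ X₁)) (g (X \ X₁)))
    (hSlotΔ : ∀ X ∈ 𝓧', ∀ X₁ ∈ ({∅} : Finset (Finset (Fin d → ZMod M))), TayNormLE ((abkmNormParams L N Mord R p r₀ h θbar A (schedDelta δ₀ δ₁ N) 𝒞).gauge k (X \ X₁)) r₀ ((abkmWeightData L N Mord R θbar (schedDelta δ₀ δ₁ N) 𝒞).midWeight k (X \ X₁))
      (fun φ => Gs (X \ X₁) φ - Gs' (X \ X₁) φ) (ρ (X \ X₁)))
    (hSlotd : ∀ X ∈ 𝓧', ∀ X₁ ∈ ({∅} : Finset (Finset (Fin d → ZMod M))), ContDiff ℝ r₀ (Gs (X \ X₁)))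
    (hSlotd' : ∀ X ∈ 𝓧', ∀ X₁ ∈ ({∅} : Finset (Finset (Fin d → ZMod M))), ContDiff ℝ r₀ (Gs' (X \ X₁)))
    (hSlotloc : ∀ X ∈ 𝓧', ∀ X₁ ∈ ({∅} : Finset (Finset (Fin d → ZMod M))), IsGaugeLocal ((abkmNormParams L N Mord R p r₀ h θbar A (schedDelta δ₀ δ₁ N) 𝒞).gauge k (X \ X₁)) (Gs (X \ X₁)))
    (hSlotloc' : ∀ X ∈ 𝓧', ∀ X₁ ∈ ({∅} : Finset (Finset (Fin d → ZMod M))), IsGaugeLocal ((abkmNormParams L N Mord R p r₀ h θbar A (schedDelta δ₀ δ₁ N) 𝒞).gauge k (X \ X₁)) (Gs' (X \ X₁)))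
    (hSlotg : ∀ X ∈ 𝓧', ∀ X₁ ∈ ({∅} : Finset (Finset (Fin d → ZMod M))), 0 ≤ g (X \ X₁)) (hSlotρ : ∀ X ∈ 𝓧', ∀ X₁ ∈ ({∅} : Finset (Finset (Fin d → ZMod M))), 0 ≤ ρ (X \ X₁)) :
    TayNormLE ((abkmNormParams L N Mord R p r₀ h θbar A (schedDelta δ₀ δ₁ N) 𝒞).gauge (k + 1) U) r₀
      ((abkmWeightData L N Mord R θbar (schedDelta δ₀ δ₁ N) 𝒞).weight (k + 1) U)
      (fun φ => ∑ X ∈ 𝓧',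
        ((bprod (L ^ k) (fun B => expNegH Ht B φ) (U \ X) * bprod (L ^ k) (fun B => expNegH (-Ht) B φ) (X \ U) - 1) *
            Gs X φ -
          (bprod (L ^ k) (fun B => expNegH Ht' B φ) (U \ X) * bprod (L ^ k) (fun B => expNegH (-Ht') B φ) (X \ U) - 1) *
            Gs' X φ))
      ((∑ X ∈ 𝓧', ∑ X₁ ∈ ({∅} : Finset (Finset (Fin d → ZMod M))),
        (((∏ _B ∈ blocks (L ^ k) (U \ X), (Real.exp (1 / 4) +
              16 * Real.exp (3 / 8) * hamNorm (fieldWt h (L : ℝ) d k) ((L : ℝ) ^ k) (L ^ (d * k)) (Ht - Ht'))) -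
            ∏ _B ∈ blocks (L ^ k) (U \ X), Real.exp (1 / 4)) *
            (∏ _B ∈ blocks (L ^ k) (X \ U), Real.exp (1 / 4)) *
            ((∏ _B ∈ blocks (L ^ k) X₁, 8 * Real.exp (1 / 4) * τ) *
              g (X \ X₁)) +
          (∏ _B ∈ blocks (L ^ k) (U \ X), Real.exp (1 / 4)) *
            ((∏ _B ∈ blocks (L ^ k) (X \ U), (Real.exp (1 / 4) +
              16 * Real.exp (3 / 8) * hamNorm (fieldWt h (L : ℝ) d k) ((L : ℝ) ^ k) (L ^ (d * k)) (Ht - Ht'))) -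
              ∏ _B ∈ blocks (L ^ k) (X \ U), Real.exp (1 / 4)) *
            ((∏ _B ∈ blocks (L ^ k) X₁, 8 * Real.exp (1 / 4) * τ) *
              g (X \ X₁)) +
          (∏ _B ∈ blocks (L ^ k) (U \ X), Real.exp (1 / 4)) * (∏ _B ∈ blocks (L ^ k) (X \ U), Real.exp (1 / 4)) *
            (((∏ _B ∈ blocks (L ^ k) X₁, (8 * Real.exp (1 / 4) * τ +
                16 * Real.exp (3 / 8) * hamNorm (fieldWt h (L : ℝ) d k) ((L : ℝ) ^ k) (L ^ (d * k)) (Ht - Ht'))) -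
              ∏ _B ∈ blocks (L ^ k) X₁, 8 * Real.exp (1 / 4) * τ) *
              g (X \ X₁)) +
          (∏ _B ∈ blocks (L ^ k) (U \ X), Real.exp (1 / 4)) * (∏ _B ∈ blocks (L ^ k) (X \ U), Real.exp (1 / 4)) *
            ((∏ _B ∈ blocks (L ^ k) X₁, 8 * Real.exp (1 / 4) * τ) *
              (0 : ℝ)))) +
      (∑ X ∈ 𝓧', ∑ X₁ ∈ ({∅} : Finset (Finset (Fin d → ZMod M))),
        (((∏ _B ∈ blocks (L ^ k) (U \ X), (Real.exp (1 / 4) +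
              16 * Real.exp (3 / 8) * hamNorm (fieldWt h (L : ℝ) d k) ((L : ℝ) ^ k) (L ^ (d * k)) (Ht' - 0))) -
            ∏ _B ∈ blocks (L ^ k) (U \ X), Real.exp (1 / 4)) *
            (∏ _B ∈ blocks (L ^ k) (X \ U), Real.exp (1 / 4)) *
            ((∏ _B ∈ blocks (L ^ k) X₁, 8 * Real.exp (1 / 4) * τ) *
              ρ (X \ X₁)) +
          (∏ _B ∈ blocks (L ^ k) (U \ X), Real.exp (1 / 4)) *
            ((∏ _B ∈ blocks (L ^ k) (X \ U), (Real.exp (1 / 4) +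
              16 * Real.exp (3 / 8) * hamNorm (fieldWt h (L : ℝ) d k) ((L : ℝ) ^ k) (L ^ (d * k)) (Ht' - 0))) -
              ∏ _B ∈ blocks (L ^ k) (X \ U), Real.exp (1 / 4)) *
            ((∏ _B ∈ blocks (L ^ k) X₁, 8 * Real.exp (1 / 4) * τ) *
              ρ (X \ X₁)) +
          (∏ _B ∈ blocks (L ^ k) (U \ X), Real.exp (1 / 4)) * (∏ _B ∈ blocks (L ^ k) (X \ U), Real.exp (1 / 4)) *
            (((∏ _B ∈ blocks (L ^ k) X₁, (8 * Real.exp (1 / 4) * τ +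
                16 * Real.exp (3 / 8) * hamNorm (fieldWt h (L : ℝ) d k) ((L : ℝ) ^ k) (L ^ (d * k)) (Ht' - 0))) -
              ∏ _B ∈ blocks (L ^ k) X₁, 8 * Real.exp (1 / 4) * τ) *
              ρ (X \ X₁)) +
          (∏ _B ∈ blocks (L ^ k) (U \ X), Real.exp (1 / 4)) * (∏ _B ∈ blocks (L ^ k) (X \ U), Real.exp (1 / 4)) *
            ((∏ _B ∈ blocks (L ^ k) X₁, 8 * Real.exp (1 / 4) * τ) *
              (0 : ℝ))))) := by
  have hL0 : (0 : ℝ) < L := by exact_mod_cast hLodd.pos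
  have hnn : ∀ H₀ : RelevantHamiltonian ℂ d,
      0 ≤ hamNorm (fieldWt h (L : ℝ) d k) ((L : ℝ) ^ k) (L ^ (d * k)) H₀ := fun H₀ =>
    hamNorm_nonneg (fieldWt_pos hh hL0 d k).le (by positivity) _ H₀
  have hτ0 : 0 ≤ τ := (hnn Ht).trans hHt
  have h0τ : hamNorm (fieldWt h (L : ℝ) d k) ((L : ℝ) ^ k) (L ^ (d * k)) (0 : RelevantHamiltonian ℂ d) ≤ τ := by
    rw [hamNorm_zero]; exact hτ0
  -- zero Lipschitz bound for a slot paired with itself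
  have hzero : ∀ (F : Finset (Fin d → ZMod M) → ((Fin d → ZMod M) → ℝ) → ℂ) (Y : Finset (Fin d → ZMod M)),
      TayNormLE ((abkmNormParams L N Mord R p r₀ h θbar A (schedDelta δ₀ δ₁ N) 𝒞).gauge k Y) r₀
        ((abkmWeightData L N Mord R θbar (schedDelta δ₀ δ₁ N) 𝒞).midWeight k Y) (fun φ => F Y φ - F Y φ) (0 : ℝ) := by
    intro F Y φ
    have hf : (fun φ : (Fin d → ZMod M) → ℝ => F Y φ - F Y φ) = fun _ => (0 : ℂ) := by funext ψ; simp
    rw [hf, tayNorm_const, norm_zero, zero_mul]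
  -- (1) `(p − p')·G`: slot form at `(H̃, H̃')`, slot `(G, G)`
  have h1 := tayNormLE_subsum_reblockTerm_sub_abkm_slot (n := n) (lam := lam) (μ := μ) (θbar := θbar) hd hLodd hL hR2
    hM hkN hp hMord hB hδ₀ hδ₁ hh hh0 hU h𝓧' (𝓨 := fun _ => ({∅} : Finset (Finset (Fin d → ZMod M))))
    (fun X hX => by
      intro X₁ hX₁; rw [mem_singleton.1 hX₁]; exact TorusPolymer.empty_mem_polys _ _)
    hHt hHt' hτ (Gs := Gs) (Gs' := Gs) (g := g) (ρ := fun _ => 0) hSlot (fun X _ X₁ _ => hzero Gs (X \ X₁))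
    hSlotd hSlotd hSlotloc hSlotloc hSlotg (fun _ _ _ _ => le_rfl)
  -- (2) `(p' − 1)·(G − G')`: slot form at `(H̃', 0)`, slot `(G − G', G − G')`
  have h2 := tayNormLE_subsum_reblockTerm_sub_abkm_slot (n := n) (lam := lam) (μ := μ) (θbar := θbar) hd hLodd hL hR2
    hM hkN hp hMord hB hδ₀ hδ₁ hh hh0 hU h𝓧' (𝓨 := fun _ => ({∅} : Finset (Finset (Fin d → ZMod M))))
    (fun X hX => by
      intro X₁ hX₁; rw [mem_singleton.1 hX₁]; exact TorusPolymer.empty_mem_polys _ _)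
    hHt' h0τ hτ (Gs := fun Y φ => Gs Y φ - Gs' Y φ) (Gs' := fun Y φ => Gs Y φ - Gs' Y φ) (g := ρ) (ρ := fun _ => 0)
    hSlotΔ (fun X _ X₁ _ => hzero (fun Y φ => Gs Y φ - Gs' Y φ) (X \ X₁))
    (fun X hX X₁ hX₁ => (hSlotd X hX X₁ hX₁).sub (hSlotd' X hX X₁ hX₁))
    (fun X hX X₁ hX₁ => (hSlotd X hX X₁ hX₁).sub (hSlotd' X hX X₁ hX₁))
    (fun X hX X₁ hX₁ => IsGaugeLocal.op₂ _ (fun a b : ℂ => a - b) (hSlotloc X hX X₁ hX₁) (hSlotloc' X hX X₁ hX₁))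
    (fun X hX X₁ hX₁ => IsGaugeLocal.op₂ _ (fun a b : ℂ => a - b) (hSlotloc X hX X₁ hX₁) (hSlotloc' X hX X₁ hX₁))
    hSlotρ (fun _ _ _ _ => le_rfl)
  -- smoothness of the two summed functionals
  have hcdE : ∀ (H₀ : RelevantHamiltonian ℂ d) (Z : Finset (Fin d → ZMod M)),
      ContDiff ℝ r₀ (fun φ : (Fin d → ZMod M) → ℝ => bprod (L ^ k) (fun B => expNegH H₀ B φ) Z) := by
    intro H₀ Z
    unfold TorusPolymer.bprod
    exact contDiff_prod fun B _ => (contDiff_eval H₀ B (n := r₀)).neg.cexp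
  have hcd3 : ∀ (H₀ : RelevantHamiltonian ℂ d) (Z : Finset (Fin d → ZMod M)),
      ContDiff ℝ r₀ (fun φ : (Fin d → ZMod M) → ℝ => bprod (L ^ k) (fun B => 1 - expNegH H₀ B φ) Z) := by
    intro H₀ Z
    unfold TorusPolymer.bprod
    exact contDiff_prod fun B _ => contDiff_const.sub (contDiff_eval H₀ B (n := r₀)).neg.cexp
  have hGcd : ∀ X ∈ 𝓧', ∀ X₁ ∈ ({∅} : Finset (Finset (Fin d → ZMod M))), ContDiff ℝ r₀ (Gs (X \ X₁)) :=
    fun X hX X₁ hX₁ => hSlotd X hX X₁ hX₁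
  have hDcd : ∀ X ∈ 𝓧', ∀ X₁ ∈ ({∅} : Finset (Finset (Fin d → ZMod M))),
      ContDiff ℝ r₀ (fun φ : (Fin d → ZMod M) → ℝ => Gs (X \ X₁) φ - Gs' (X \ X₁) φ) :=
    fun X hX X₁ hX₁ => (hSlotd X hX X₁ hX₁).sub (hSlotd' X hX X₁ hX₁)
  have hcd1 : ContDiff ℝ r₀ (fun φ : (Fin d → ZMod M) → ℝ => ∑ X ∈ 𝓧',
      ∑ X₁ ∈ ({∅} : Finset (Finset (Fin d → ZMod M))),
        (bprod (L ^ k) (fun B => expNegH Ht B φ) (U \ X) * bprod (L ^ k) (fun B => expNegH (-Ht) B φ) (X \ U) *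
            (bprod (L ^ k) (fun B => 1 - expNegH Ht B φ) X₁ * Gs (X \ X₁) φ) -
          bprod (L ^ k) (fun B => expNegH Ht' B φ) (U \ X) * bprod (L ^ k) (fun B => expNegH (-Ht') B φ) (X \ U) *
            (bprod (L ^ k) (fun B => 1 - expNegH Ht' B φ) X₁ * Gs (X \ X₁) φ))) := by
    refine ContDiff.sum fun X hX => ContDiff.sum fun X₁ hX₁ => ?_
    exact ((((hcdE Ht (U \ X)).mul (hcdE (-Ht) (X \ U))).mul ((hcd3 Ht X₁).mul (hGcd X hX X₁ hX₁))).sub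
      (((hcdE Ht' (U \ X)).mul (hcdE (-Ht') (X \ U))).mul ((hcd3 Ht' X₁).mul (hGcd X hX X₁ hX₁))))
  have hcd2 : ContDiff ℝ r₀ (fun φ : (Fin d → ZMod M) → ℝ => ∑ X ∈ 𝓧',
      ∑ X₁ ∈ ({∅} : Finset (Finset (Fin d → ZMod M))),
        (bprod (L ^ k) (fun B => expNegH Ht' B φ) (U \ X) * bprod (L ^ k) (fun B => expNegH (-Ht') B φ) (X \ U) *
            (bprod (L ^ k) (fun B => 1 - expNegH Ht' B φ) X₁ * (Gs (X \ X₁) φ - Gs' (X \ X₁) φ)) -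
          bprod (L ^ k) (fun B => expNegH 0 B φ) (U \ X) * bprod (L ^ k) (fun B => expNegH (-0) B φ) (X \ U) *
            (bprod (L ^ k) (fun B => 1 - expNegH 0 B φ) X₁ * (Gs (X \ X₁) φ - Gs' (X \ X₁) φ)))) := by
    refine ContDiff.sum fun X hX => ContDiff.sum fun X₁ hX₁ => ?_
    exact ((((hcdE Ht' (U \ X)).mul (hcdE (-Ht') (X \ U))).mul ((hcd3 Ht' X₁).mul (hDcd X hX X₁ hX₁))).sub
      (((hcdE 0 (U \ X)).mul (hcdE (-0) (X \ U))).mul ((hcd3 0 X₁).mul (hDcd X hX X₁ hX₁))))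
  have hsum := h1.add h2 hcd1 hcd2
  -- identify the function
  intro φ
  refine le_of_eq_of_le ?_ (hsum φ)
  congr 1
  funext ψ
  simp only [Pi.add_apply, sum_singleton, TorusPolymer.bprod_empty, sdiff_empty, expNegH_zero, neg_zero,
    bprod_one, one_mul]
  rw [← sum_add_distrib]
  exact sum_congr rfl fun X _ => by ring

end Literature.MathematicalPhysics.StatisticalMechanics.GradientRG

end
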